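import Summits.QuantumAdvantage.QuantumAdvantage.Theses.ArithStatLadder
import Summits.QuantumAdvantage.QuantumAdvantage.Theorems.IqThreeMemBQP.Negative.RefutationCost
import Literature.Computability.Cryptography.HallgrenClassGroup
import Literature.Computability.Cryptography.HallgrenPell
import Literature.Computability.Cryptography.HallgrenPellHolds
import Literature.Computability.Cryptography.HallgrenPellProofs
import Literature.Computability.Cryptography.ShorProofs
import Literature.Computability.Cryptography.ShorAssemblyLeavesProofs
import Literature.Computability.Cryptography.QuantumCircuitProofs
import Literature.Computability.Cryptography.QubitRegisterCliffordTProofs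

/-!
# Line `mirror-dodge` — skeleton for the crux `ArithStatLadder.IqThreeMemBQP`
(crux item stmt-QuantumAdvantage-2424, rank 3, route `route-QuantumAdvantage-ArithStatLadder`;
crux-plan generation 1, idea card `Cruxes/IqThreeMemBQP/Ideas/mirror-dodge.md`, triage r1-1/2/3: pass)

Crux (FIXED, by name): `IqThreeMemBQP : IQ3 ∈ BQP`, `IQ3 = bin {d : −d fundamental, 3 ∣ h(−d)}`
(`h` = `BinaryQuadraticForm.classNumber`, the tree's strict class `BQP`: P-uniform oracle-free Clifford+T
families, error `≤ 1/3`). UNCONDITIONAL — no GRH anywhere in this file.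

## "Spiegelung beats Siegel" — the MIRROR TRIPLE TEST

Every printed quantum class-group algorithm needs a generating set of `Cl(−d)` (Bach's bound, GRH;
Disproof §3). Deciding `3 ∣ h(−d)` does not: it needs ONE class of order `≡ 0 (mod 3)`, and a
near-uniform random class has that property with probability `1 − 3^{−v₃(h)} ≥ 2/3`. Near-uniform
classes come from uniformly random INTEGRAL IDEALS of norm `≤ Y = d^A` (lattice-point counting in
classes, no zeros of any `L`-function: stub `ClassEquidistribution`), at an acceptance rate
proportional to the residue `κ_K = L(1, χ_{−d})` — which a Landau–Siegel zero can starve ("dark" `d`).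
DODGE: Landau 1918 (PROVED in the tree, `DirichletZFR.exists_landau_prodChar_min_le`) + Hecke/Landau's
lower bound (`Siegel.caseA`, PROVED) say that `K = ℚ(√−d)` and its SCHOLZ MIRROR `F = ℚ(√3d)` are never
both dark (stub `MirrorBright`), and Scholz's reflection theorem refined by Kummer theory transfers
the question across the mirror up to a unit congruence:
`3 ∣ h(−d) ⟺ 3 ∣ h(F) ∨ ε_F is 3-primary` (stub `RefinedScholz`; `0` exceptions for every
fundamental `−d`, `4 < d ≤ 10⁶`, triage jobs j012989/j013007), the primarity of the fundamental unit
being read GRH-free from the tree's PROVED Hallgren–Pell stack (`Hallgren2007_regulator_qsolvable_delim_holds`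
∘ `JacobsonWilliams2008_unitResidue_mem_FP_holds`, modulus `9`).

MIRROR(d) (classical randomised polynomial time with `BQP` oracles; one-sided — never a false YES
up to oracle error): reject non-canonical words and non-fundamental `−d` (factoring, `FACT_mem_BQP_holds`);
finite table below `d₀`; (T1) accept if `ε_F` is 3-primary; (T2) draw `poly(n)` uniform ideals of
`𝓞_K` of norm `≤ d^A` (uniform `a ≤ d^A`, factor `a`, enumerate the `r_K(a) ≤ τ(a)` ideals of norm `a`,
cap `r_K(a) ≤ R = (log d)^C`), accept if one has class of order `≡ 0 (mod 3)` in the form class group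
(Shor/Cheung–Mosca over reduced forms: stub `WhiteBoxAbelianOrderQSolvable` = DarkClassGroups'
`AbelianGroupOrderFBQP`, stmt-QuantumAdvantage-3193, verbatim); (T3) the same in `F` (order of ONE
ideal class of a real quadratic field, Hallgren's `ℤ × ℝ` hidden subgroup problem with a single
generator, GRH-free: stub `RealClassOrderQSolvable` — the HARDEST stub); else reject.
Soundness: T1 ⇒ `3 ∣ h(−d)` and T3 ⇒ `3 ∣ h(F)` ⇒ `3 ∣ h(−d)` by `RefinedScholz`; T2 ⇒ `3 ∣ |Cl(𝓞_K)| = h(−d)`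
(`card_reducedForms_eq_classNumber`). Completeness: `3 ∣ h(−d)`, `¬` T1 ⇒ `3 ∣ h(F)` AND `3 ∣ h(K)`
(`RefinedScholz`), and on whichever of `K`, `F` is bright the sampler accepts at rate `≥ 1/poly(log d)`
with witness fraction `≥ 1/2` (stub `SamplerCompleteness`, from `MirrorBright` + `ClassEquidistribution`).

## THE LINE (7 registered stubs, composed by `IqThreeMemBQP_of`, kernel-checked)

* `stub_refinedScholz` (S1; theorem in print — Scholz 1932 + Kummer/Hecke; formally XXL: class field
  theory for quadratic base fields is not in Mathlib ⇒ vendor first as a Literature fact, prove later).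
* `stub_mirrorBright` (S2; M, PROVABLE NOW from tree theorems: Landau pair repulsion + `Siegel.caseA` +
  `LFunction_one_eq_dedekindZeta_residue_of_eq` + `exists_sq_eq_one_dedekindZeta_eq`).
* `stub_classEquidistribution` (S3; M–L: Weber–Landau per class with POLYNOMIAL discriminant loss for
  quadratic fields of both signatures; the tree's `IdealCountProofs` has the field-dependent version).
* `stub_realClassOrder` (S4; XL, HARDEST, the one source-risk stub: Hallgren 2005/2007 single-generator
  class-group HSP over `ℤ × ℝ`, GRH-free; the `k = 0` twin — the regulator — is PROVED in the tree).
* `stub_whiteBoxAbelianOrder` (S5; L: Cheung–Mosca/Watrous generic abelian order finding = the shared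
  open item stmt-QuantumAdvantage-3193, statement copied VERBATIM so one proof closes both).
* `stub_samplerCompleteness` (S6; M: S2 + S3 + the 3′-Hall torsion statistic + `∑ τ² ≪ Y log³Y` ⇒ on the
  bright field the capped ideal pool has polynomial rate and witness fraction `≥ 1/2`).
* `stub_mirrorProgram` (S7; XL plumbing ON TREE RAILS: the classical-base principle
  `isQSolvable_of_mem_FPRel_BQP_holds` with ONE oracle `FACT ⊕ OrdBitsK ⊕ OrdBitsF ⊕ UnitBits`
  (`IsQSolvable.paritySum`, `isQSolvable_classicalWrap_holds`, `mem_BQP_of_isQSolvable_bit`), success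
  `≥ 3/4` from S6, correctness from S1; conclusion `IsQSolvable iqThreeBitRel` = "the decision bit in FBQP").
* PROVED here: `iqThreeMemBQP_iff` (reading, `Iff.rfl`), `iqThreeBit_eq_true_iff`,
  `IqThreeMemBQP_of_parts`, and `IqThreeMemBQP_of` — the composition concluding the crux BY NAME from
  the seven stub STATEMENTS (`mem_BQP_of_isQSolvable_bit` with the tree's discharged
  `QCircuit.outputPMF_apply_holds`, `cliffordT_isUnitary_holds`, `Hallgren2007_regulator_qsolvable_delim_holds`,
  `JacobsonWilliams2008_unitResidue_mem_FP_holds`, `FACT_mem_BQP_holds`): `IqThreeMemBQP_of_parts` takes the seven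
  stub STATEMENTS as hypotheses and proves `IQ3 ∈ BQP`; `IqThreeMemBQP_of` applies it to the registered stubs and
  is the one theorem whose type is literally the route decl.

Triage sharpenings adopted (r1-1 §sharpen, r1-2 "For the lead", r1-3 "Net recommendation"): IDEAL
sampler instead of the card's prime sampler (so `ThornerZaman2019_classPNT_*`, an unproved named fact,
and the card's K2/K4 `IndexThreeRelativeEscape`/`BrightSideAbundance` leave the cone entirely — the only
`L`-function input left is Landau + caseA, both PROVED); real-side primitive weakened to ONE class
(`k = 1`), accepting arbitrary ideals `(a, b + θ)` (not only primes; `p = 2` degenerate case moot);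
unit residue modulus `9`; both signatures of the equidistribution lemma with explicit `poly(disc)` loss
(real side = unit-sector decomposition, `O(R_F √s)` per class); truncation `r(a) ≤ R` coupled to the
rate inside S6 (r1-3 sharpen on torsion-witness-sampling).

Disproof.lean (cdisprove cycle 1/1b) honoured: no `_false_without_` theorem exists (the crux has no
hypotheses); §3's load ("poly(log d) generating set of Cl(−d)") is DENIED, not met — no stub generates
or enumerates a class group; §4bis (`d = 547`, no prime form of norm `≤ log₂ d`) is consistent (norms up
to `d^A`; `d = 547` is in fact a unit-defect input, decided by T1 alone, j013007); §0/§1 model facts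
(`[] ∉ IQ3`, non-canonical words rejected, acceptance on wire `0`) are S7's classical syntax check and
`mem_BQP_of_isQSolvable_bit`. Landed Negative lemmas for THIS crux:
`Theorems/IqThreeMemBQP/Negative/RefutationCost.lean` (imported; reading / small models / cost of a
refutation) — no stub is an instance it refutes. Negatives index (`ledger negatives`: CubicForrelation,
SeparableFrames, KummerSector, ShorLocallyDark): unrelated shapes. No stub restates the crux, the
summit, the route target `IqThreeNotPPoly`, or a refuted statement; S7's conclusion is the decision
bit as a SEARCH problem and carries seven antecedents.
-/

set_option linter.dupNamespace false
set_option linter.unusedVariables false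

noncomputable section

open scoped Classical nonZeroDivisors NumberField

namespace Summit.QuantumAdvantage.QuantumAdvantage.Cruxes.IqThreeMemBQP.MirrorDodge

open _root_.Computability Literature.Computability.Complexity Literature.Computability.Cryptography
open Literature.NumberTheory.QuadraticFields
open Summit.QuantumAdvantage.QuantumAdvantage.Theses.ArithStatLadder (IqThreeMemBQP)

/-! ## Vocabulary (inlined notions of the line; all over existing declarations) -/

/-- The set `S = {d : −d fundamental, 3 ∣ h(−d)}` of the crux (`IsNegFundamentalDiscr` of
`HallgrenClassGroup.lean` is verbatim the route file's inline disjunction). -/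
def iqThreeSet : Set ℕ :=
  {d | IsNegFundamentalDiscr d ∧ 3 ∣ BinaryQuadraticForm.classNumber (-(d : ℤ))}

/-- The language `IQ3 = bin(S)` (image of Mathlib's `encodeNat`, LSB first; `[] ∉ IQ3`). -/
def iqThreeLang : Language Bool :=
  encodingNatBool.toLanguage iqThreeSet

/-- READING: the crux is literally `IQ3 ∈ BQP` (cf. `Negative.RefutationCost.iqThreeMemBQP_iff`). -/
theorem iqThreeMemBQP_iff : IqThreeMemBQP ↔ iqThreeLang ∈ BQP := Iff.rfl

/-- The decision bit `[x ∈ IQ3]` (classical). -/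
def iqThreeBit (x : List Bool) : Bool := decide (x ∈ iqThreeLang)

theorem iqThreeBit_eq_true_iff (x : List Bool) : iqThreeBit x = true ↔ x ∈ iqThreeLang := by
  simp [iqThreeBit]

/-- The decision bit as a SEARCH relation (write `[x ∈ IQ3]` on wire `0`; closed under extension). -/
def iqThreeBitRel (x : List Bool) : Set (List Bool) := {z | [iqThreeBit x] <+: z}

/-- The square-free kernel `m` of a negative fundamental discriminant `−d` (`d = m` or `d = 4m`). -/
def sqfKernel (d : ℕ) : ℕ := if 4 ∣ d then d / 4 else d

/-- The square-free radicand of the SCHOLZ MIRROR `F = ℚ(√3d) = ℚ(√(mirrorRadicand d))`: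
`3m` if `3 ∤ d`, `m/3` if `3 ∣ d` (`m = sqfKernel d`); square-free and `≥ 2` for fundamental `−d`, `d > 4`. -/
def mirrorRadicand (d : ℕ) : ℕ := if 3 ∣ d then sqfKernel d / 3 else 3 * sqfKernel d

/-- "`(a, b)` is the least solution of `a² − D b² = ±4` with `b > 0`", i.e. `ε_D = (a + b√D)/2` is the
fundamental unit `> 1` of `ℚ(√D)`, `D` square-free — VERBATIM the arithmetic description of the unit in the
tree fact `JacobsonWilliams2008_unitResidue_mem_FP` (whose PROVED `_holds` form S7 consumes), so that the
residues `(a mod 9, b mod 9)` it outputs are residues of THIS pair. -/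
def IsLeastUnitPair (D a b : ℕ) : Prop :=
  0 < b ∧ ((a : ℤ) ^ 2 - (D : ℤ) * (b : ℤ) ^ 2 = 4 ∨ (a : ℤ) ^ 2 - (D : ℤ) * (b : ℤ) ^ 2 = -4) ∧
    ∀ a' b' : ℕ, 0 < b' →
      ((a' : ℤ) ^ 2 - (D : ℤ) * (b' : ℤ) ^ 2 = 4 ∨ (a' : ℤ) ^ 2 - (D : ℤ) * (b' : ℤ) ^ 2 = -4) → a ≤ a'

/-- **3-primarity of the mirror unit** `ε_F = (a + b√D')/2`, `D' = mirrorRadicand d`, as a congruence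
(Hecke: `M(∛ε)/M` unramified above `3`, `M = F(√−3)`, iff `ε` is a cube mod `λ³`):
* `3 ∤ d` (`3 ∣ D'`, `(3) = 𝔭²` in `F`, `N ε = +1` forced): `ε ≡ ±1 (mod 𝔭³) ⟺ 3 ∣ b`;
* `3 ∣ d` (`3 ∤ D'`): `ε⁸ ≡ 1 (mod 9𝓞_F) ⟺ z⁸ ≡ 256 (mod 9ℤ[√D'])`, `z = a + b√D' = 2ε`
  (`ℤ[√D'] ∩ 9𝓞_F = 9ℤ[√D']`, `gcd(256, 9) = 1`).
Both depend only on `(a mod 9, b mod 9)`. Numerically identical with the intrinsic criterion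
`v₃(disc ℚ(∛η + ∛η̄)) = v₃(d)` on all 303 967 fundamental `−d`, `4 ≤ d ≤ 10⁶` (triage r1-3, j012989/j013007,
law "C3"); hand checks `d = 23, 31` (primary, `h = 3`), `d = 24` (no), `87` (yes). -/
def IsPrimary (d a b : ℕ) : Prop :=
  (¬ 3 ∣ d ∧ 3 ∣ b) ∨
    (3 ∣ d ∧ (9 : ℤ) ∣ ((⟨a, b⟩ : ℤ√(mirrorRadicand d : ℤ)) ^ 8).re - 256 ∧
      (9 : ℤ) ∣ ((⟨a, b⟩ : ℤ√(mirrorRadicand d : ℤ)) ^ 8).im)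

/-- `N_C(s) = #{I ⊴ 𝓞_L nonzero : N(I) ≤ s, [I] = C}` (the shape of the tree's
`Literature.NumberTheory.LFunctions.NumberField.abs_card_norm_le_and_mk_eq_sub_le`). -/
def classCount (L : Type) [Field L] [NumberField L] (C : ClassGroup (𝓞 L)) (s : ℝ) : ℕ :=
  Nat.card {I : (Ideal (𝓞 L))⁰ // (Ideal.absNorm (I : Ideal (𝓞 L)) : ℝ) ≤ s ∧ ClassGroup.mk0 I = C}

/-- `r_L(n) = #{I ⊴ 𝓞_L : N(I) = n}` (`≤ τ(n)` in a quadratic field: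
`card_ideals_absNorm_eq_le_card_divisors`, PROVED). -/
def normMult (L : Type) [Field L] [NumberField L] (n : ℕ) : ℕ :=
  Nat.card {J : (Ideal (𝓞 L))⁰ // Ideal.absNorm (J : Ideal (𝓞 L)) = n}

/-- THE SAMPLER'S POOL: nonzero ideals of norm `≤ Y` whose norm carries at most `R` ideals. The
classical sampler of S7 (uniform `a ≤ Y`; factor `a`; enumerate the `r_L(a)` ideals of norm `a`, discarding
`a` if `r_L(a) > R`; uniform `j ≤ R`, output the `j`-th ideal if `j ≤ r_L(a)`) outputs the UNIFORM law on
this pool and accepts with probability exactly `#pool / (Y·R)` per trial. -/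
def samplerPool (L : Type) [Field L] [NumberField L] (Y R : ℕ) : Set (Ideal (𝓞 L))⁰ :=
  {I | Ideal.absNorm (I : Ideal (𝓞 L)) ≤ Y ∧ normMult L (Ideal.absNorm (I : Ideal (𝓞 L))) ≤ R}

/-- The TORSION WITNESSES in the pool: ideals whose class has order `≡ 0 (mod 3)`. -/
def witnessPool (L : Type) [Field L] [NumberField L] (Y R : ℕ) : Set (Ideal (𝓞 L))⁰ :=
  {I | I ∈ samplerPool L Y R ∧ 3 ∣ orderOf (ClassGroup.mk0 I)}

/-- "The pool of `L` is GOOD at sizes `(Y, R)` with rate bound `E`": acceptance probability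
`#pool/(Y R) ≥ 1/E` and witness fraction `≥ 1/2`. -/
def PoolGood (L : Type) [Field L] [NumberField L] (Y R E : ℕ) : Prop :=
  Y * R ≤ E * Nat.card (samplerPool L Y R) ∧
    Nat.card (samplerPool L Y R) ≤ 2 * Nat.card (witnessPool L Y R)

/-- Integral generator of a real quadratic ring of integers, pinned numerically for S4's input
convention: `θ = (1 + √D)/2` if `D ≡ 1 (mod 4)` (coefficients `(2, 1)`: `(2θ − 1)² = D`), else `θ = √D`
(coefficients `(1, 0)`: `θ² = D`); then `𝓞_F = ℤ[θ]` for square-free `D` and every nonzero ideal is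
`g · (ℤ a + ℤ (b + θ))` with `0 ≤ b < a = N`, uniquely. -/
def thetaCoeffs (D : ℕ) : ℕ × ℕ := if D % 4 = 1 then (2, 1) else (1, 0)

/-! ## Stub statements -/

/-- **S1 — `RefinedScholz`** (Scholz 1932 reflection with the unit defect; the hinge of the line).
For a negative fundamental discriminant `−d` with `d > 4` (excludes only the degenerate `d = 3`, where
`ℚ(√9) = ℚ`; `d = 4` is a table entry anyway), the mirror `F ≅ ℚ(√3d)` (ANY quadratic number field in
which `3d` is a square) and its fundamental unit `ε_F = (a + b√D')/2`, `D' = mirrorRadicand d`: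
`3 ∣ h(−d) ⟺ 3 ∣ h_F ∨ ε_F is 3-primary`.
Proof in print: Kummer theory over `M = ℚ(√−d, √−3) = F(√−3)`: unramified `C₃`-extensions of
`K = ℚ(√−d)` ↔ 3-primary lines of `V_F = {α ∈ F× : (α) = 𝔞³}/F׳ = ⟨ε_F⟩ ⊕ (lift of Cl(F)[3])`
(`dim = 1 + r₃(F)`, norm condition automatic), the primary subspace having codimension `≤ 1` (Hecke's
criterion at `𝔓 ∣ 3`, `v_𝔓(1 − ζ₃) = 1`); with class field theory (`Cl(K)/3 ≅ Gal(H₃/K)`) this gives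
Scholz's `r₃(F) ≤ r₃(K) ≤ r₃(F) + 1` AND: `¬prim ⇒ r₃(K) = r₃(F)`, `prim ⇒ r₃(K) ≥ 1` — i.e. the statement
(triage r1-1 §A, r1-2 (a): independent derivations). `h(−d)` is the form class number = `h_K`
(`card_reducedForms_eq_classNumber`, PROVED). Second printed route (card K1 bis, `d ≢ 2 mod 3`): Leopoldt's
3-adic class number formula + the Iwasawa congruence `L₃(1, χ_F) ≡ L₃(0, χ_F) (mod 3)`.
Numerics: 0 exceptions among all 303 967 fundamental `−d`, `4 ≤ d ≤ 10⁶` (121 645 with `3 ∣ h`; 86 279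
unit-defect fields), in this exact spelling (law C3) and two equivalent ones (j012989, j013007, j009188,
`mirror_check_30000`, `scholz_py_check_100000`). Why it might fail: only as a MISSTATEMENT of the
congruence in a residue sub-case (repair from Llorente–Quer 1988 / Kishi 2000 / Hecke as above — the
lever survives); formally XXL (CFT for quadratic base fields absent from Mathlib) ⇒ vendor as a
Literature named fact from Scholz1932 (doi:10.1515/crll.1932.166.201) / Washington GTM 83 Thm 10.10 /
KraftWashington2006 Thm 1 / LlorenteQuer1988 first. A CFT-free formal path worth a remark: Bhargava HCL-I /
Eisenstein–Arndt parametrise `Cl(D)[3]` by binary cubic forms of discriminant `D` elementarily.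
[cite: Scholz1932] [cite: Buell1989, Thm 8.6] [cite: Washington1997, Thm 10.10] -/
def RefinedScholz : Prop :=
  ∀ d : ℕ, IsNegFundamentalDiscr d → 4 < d →
    ∀ (F : Type) [Field F] [NumberField F], Module.finrank ℚ F = 2 →
      (∃ α : F, α ^ 2 = ((3 * d : ℕ) : F)) →
        ∀ a b : ℕ, IsLeastUnitPair (mirrorRadicand d) a b →
          (3 ∣ BinaryQuadraticForm.classNumber (-(d : ℤ)) ↔
            3 ∣ NumberField.classNumber F ∨ IsPrimary d a b)

/-- **S2 — `MirrorBright`** (Landau 1918 × Hecke–Landau: a field and its mirror are never both dark),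
in the currency the sampler uses — the residue `κ_L = Res_{s=1} ζ_L` (Mathlib
`NumberField.dedekindZeta_residue`; for a quadratic field `κ_L = L(1, χ_{d_L})`, tree
`LFunction_one_eq_dedekindZeta_residue_of_eq` with `exists_sq_eq_one_dedekindZeta_eq`): there are
`c > 0`, `d₀` with `κ_K ≥ c/log d` or `κ_F ≥ c/log d` for every fundamental `−d`, `d ≥ d₀`, `K` of
discriminant `−d`, `F ≅ ℚ(√3d)`. PROVABLE NOW (triage r1-1/2/3): the Kronecker characters of `K` and `F`
are quadratic, nontrivial, of DISTINCT conductors `d ≠ |d_F| ∈ {3d, 12d, d/3, 4d/3}` (primitive mod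
`|disc|`: `JacobiCharacterPrimitiveProofs`), so `prodChar ≠ 1` (`DirichletZFR.prodChar_ne_one_of_isPrimitive`)
and `DirichletZFR.exists_landau_prodChar_min_le` (PROVED, MV Thm 11.7) leaves at most one of the two
`L`-functions a real zero in `(1 − c_L/log(4q₁q₂), 1)`; for the other, `Siegel.caseA` (PROVED; general
modulus, free `η ≤ 1/4`) with `η = min(1/4, c_L/log(4q₁q₂))` gives
`Re L(1, χ) ≥ C_E η (Bq)^{−A_E η} ≥ c/log d`. No Siegel (ineffective) input. Why it might fail: it cannot
(all inputs are tree theorems); size M (character bookkeeping for even discriminants).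
[cite: MontgomeryVaughan2007, Thm 11.7] [cite: Landau1918] -/
def MirrorBright : Prop :=
  ∃ c : ℝ, 0 < c ∧ ∃ d₀ : ℕ, ∀ d : ℕ, IsNegFundamentalDiscr d → d₀ ≤ d →
    ∀ (K : Type) [Field K] [NumberField K], Module.finrank ℚ K = 2 →
      NumberField.discr K = -(d : ℤ) →
    ∀ (F : Type) [Field F] [NumberField F], Module.finrank ℚ F = 2 →
      (∃ α : F, α ^ 2 = ((3 * d : ℕ) : F)) →
        c / Real.log d ≤ NumberField.dedekindZeta_residue K ∨
          c / Real.log d ≤ NumberField.dedekindZeta_residue F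

/-- **S3 — `ClassEquidistribution`** (Weber–Landau per ideal class, UNIFORM over quadratic fields of both
signatures with polynomial discriminant loss): absolute `A, B` with
`|N_C(s) − (κ_L/h_L)·s| ≤ B·|d_L|^A·√s` for every quadratic `L`, class `C`, `s ≥ 1`. (Per-class main term
`κ_L/h_L = 2^{r₁}(2π)^{r₂} R_L/(w_L √|d_L|)`.) The tree PROVES the field-dependent version
(`IdealCountProofs.abs_card_norm_le_and_mk_eq_sub_le`: `∃ A B` per `(L, C)`, error `s^{1−1/2}`); the stub
is the uniformity. Imaginary `L`: ideals in `C` of norm `≤ s` ↔ (`1/w` of) the points of the lattice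
`J ∈ C⁻¹` in the disc of radius `√(s N J)`; `λ₁(J) ≥ √(N J)`, covolume `N(J)√|d_L|/2` ⇒ error `O(√s + 1)`
ABSOLUTE (equivalently: reduced forms have `λ_min ≥ a/2`, triage r1-1 on `UniformEllipseCount`). Real `L`:
the unit sector `{1 ≤ |x₁/x₂|·λ < ε²}` is `e^{2R}`-elongated, but every diagonal image `g·J`,
`g = diag(eᵗ, e⁻ᵗ)`, still has `λ₁ ≥ √(2 N J)` (`|x₁x₂| ≥ N J` on `J ∖ 0`) and the same covolume; cut the
sector into `O(R_L + 1)` pieces of bounded ratio, rebalance each by a diagonal `g`, count with Lipschitz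
boundary: error `O((R_L + 1)(√s + 1))` per class, and `R_L ≤ √d_L log d_L` (`h R = κ√d/2`, `κ ≪ log d`) ⇒
`A = 1/2 + o(1)` suffices (triage r1-1 on `ideals_equidistribute_in_classes`; Landau 1918; Debaene 2019
for explicit constants). Why it might fail: only in constants/exponents as typed (`A, B` existential);
size M (imaginary) + L (real: the sector decomposition is not in the tree; the regulator, fundamental
domain and `IdealCountProofs` machinery are). [cite: Marcus2018, Ch. 6 Thm 39] [cite: Landau1918] -/
def ClassEquidistribution : Prop :=
  ∃ A B : ℝ, ∀ (L : Type) [Field L] [NumberField L], Module.finrank ℚ L = 2 →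
    ∀ (C : ClassGroup (𝓞 L)) (s : ℝ), 1 ≤ s →
      |(classCount L C s : ℝ) - NumberField.dedekindZeta_residue L / NumberField.classNumber L * s|
        ≤ B * |(NumberField.discr L : ℝ)| ^ A * Real.sqrt s

/-- **S4 — `RealClassOrderQSolvable`** (HARDEST; the one GRH-free quantum primitive the line adds to the
tree): the order of ONE ideal class of a real quadratic field in quantum polynomial time, no GRH.
Input `⟨bin D, ⟨bin a, bin b⟩⟩` with `D ≥ 2` square-free (promise checkable with the `FACT` oracle);
for `F ≅ ℚ(√D)` (any quadratic number field with the pinned integral generator `θ`, `thetaCoeffs`: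
`(2θ − 1)² = D` if `D ≡ 1 (4)`, `θ² = D` otherwise) and the ideal `I = (a, b + θ) ⊴ 𝓞_F` (every
nonzero ideal is `g·I` for such data with `0 ≤ b < a = N I`; `[g I] = [I]`), output `bin (ord [I])` as a
prefix whenever `I ≠ 0`. The answer does not depend on the choices (`F` unique up to isomorphism; `θ ↦ θ̄`
sends `I` to its conjugate = inverse class, same order). In print INSIDE Hallgren's class-group
algorithm (Hallgren 2005 STOC §4 / 2007 J.ACM §6–7; Childs–van Dam 2010 §5: GRH enters only to make
`poly(log D)` prime ideals GENERATE; Biasse–Song 2016 for arbitrary degree): with the regulator `R`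
known (tree: `Hallgren2007_regulator_qsolvable_delim_holds`, PROVED, `HallgrenPellQuantum.lean`), the map
`e ↦ |cycle state of the reduced ideals of I^e, discretised along the distance coordinate⟩` is
`ord[I]`-periodic on `ℤ` with pairwise near-orthogonal values (distinct classes have disjoint cycles),
so Shor/Kitaev period finding over `ℤ` (or the HSP over `ℤ × ℝ` for the lattice
`{(e, x) : I^e = (α), x ≡ log|α| mod R}`) returns `ord [I] ≤ h_F < D`; ideal arithmetic / reduction in the
infrastructure is classical P-time (tree: `Infrastructure*`, `RealQuadraticPrincipalCycle`,
`HallgrenCycle`, `HallgrenGiantStep`, `HallgrenWalkOps`). Why it might fail: not mathematically; the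
`k = 1` extraction and the precision analysis (cycle-state fidelity uniform in `D`) must be re-read from
Hallgren 2007 §6 / Schmidt–Vollmer 2005 (acq-02329, acq-04931 want-only; held: Jozsa quant-ph/0302134,
Childs–van Dam arXiv:0812.0380 §5); formally XL (the tree has the 1-dim period finding with irrational
period PROVED, not the state-valued HSP). Fallback (triage r1-2 (c)): on a bright `F`, `O(log h_F)`
sampled classes GENERATE `Cl(F)` w.h.p., so Hallgren's class-GROUP theorem can be used verbatim with
sampled generators. [cite: Hallgren2007] [cite: Hallgren2005] [cite: ChildsVandam2010, §5] [cite: BiasseSong2015] -/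
def RealClassOrderQSolvable : Prop :=
  IsQSolvable fun x : List Bool =>
    {y | ∀ (F : Type) [Field F] [NumberField F] (D a b : ℕ) (θ : 𝓞 F),
      x = boolPair (encodeNat D) (boolPair (encodeNat a) (encodeNat b)) →
        Squarefree D → 2 ≤ D → Module.finrank ℚ F = 2 →
          (((thetaCoeffs D).1 : F) * (θ : F) - ((thetaCoeffs D).2 : F)) ^ 2 = (D : F) →
            ∀ hI : Ideal.span {(a : 𝓞 F), (b : 𝓞 F) + θ} ∈ (Ideal (𝓞 F))⁰,
              encodeNat (orderOf (ClassGroup.mk0 ⟨_, hI⟩)) <+: y}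

/-- **S5 — `WhiteBoxAbelianOrderQSolvable`** (Cheung–Mosca 2001 / Mosca 1999 / Watrous 2001 §3: order of
the subgroup generated by given elements of a WHITE-BOX finite abelian group with unique labels and
P-time law, in quantum polynomial time). THE STATEMENT IS VERBATIM `DarkClassGroups.AbelianGroupOrderFBQP`
(item stmt-QuantumAdvantage-3193, open, shared with route PadKuperberg) — one proof closes both (`exact`).
Used by S7 at `k = 1` for the FORM CLASS GROUP of discriminant `−d`: labels = reduced primitive positive
definite forms (`BinaryQuadraticForm.mem_reducedForms_iff`), `one` = principal form, `mul` = Dirichlet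
composition + reduction (tree FP programs `composeGC`, `reduceGC` in `HallgrenClassGroupReduceFP.lean`;
group axioms through the injection `FormGroup.classOf` into `ClassGroup (𝓞 K)`: `classOf_compose`,
`classOf_reduce`, `classOf_inj`, `exists_classOf_eq`, all PROVED), so `|⟨f⟩| = ord [f]`. In print:
orders `rᵢ` by Shor period finding on `a ↦ gᵢ^a`, hidden subgroup of `ℤ_{r₁} × … × ℤ_{r_k} → G`, Smith
normal form; tree rails `orderBitLang`, `isQSolvable_of_mem_FPRel_BQP_holds`. Why it might fail: not
mathematically; as typed ONE uniform family must compile the abstract P-time `mul` reversibly and reach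
`2/3` on every valid input incl. `k = 0` and junk `prm` (DarkClassGroups kill-criterion (c): a restate
risk, not maths); size L. [cite: CheungMosca2001] [cite: Watrous2001, §3] [cite: Kitaev1995] -/
def WhiteBoxAbelianOrderQSolvable : Prop :=
  ∀ (lab : List Bool → List Bool → Bool) (one : List Bool → List Bool)
    (mul : List Bool → List Bool → List Bool → List Bool),
    ((∀ p g h, lab p g = true → lab p h = true → lab p (mul p g h) = true) ∧
      (∀ p, lab p (one p) = true) ∧ (∀ p g, lab p g = true → mul p (one p) g = g) ∧
      (∀ p g h k, lab p g = true → lab p h = true → lab p k = true →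
        mul p (mul p g h) k = mul p g (mul p h k)) ∧
      (∀ p g h, lab p g = true → lab p h = true → mul p g h = mul p h g) ∧
      (∀ p g, lab p g = true → ∃ h, lab p h = true ∧ mul p g h = one p) ∧
      (∀ p g, lab p g = true → g.length ≤ p.length)) →
    (Literature.Computability.Complexity.PolyTimeComputable
        (fun q : List Bool × List Bool => Literature.Computability.Complexity.boolPair q.1 q.2)
        Computability.encodeBool (fun q : List Bool × List Bool => lab q.1 q.2) ∧
      Literature.Computability.Complexity.PolyTimeComputable (id : List Bool → List Bool)
        (id : List Bool → List Bool) one ∧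
      Literature.Computability.Complexity.PolyTimeComputable
        (fun t : List Bool × List Bool × List Bool =>
          Literature.Computability.Complexity.boolPair t.1
            (Literature.Computability.Complexity.boolPair t.2.1 t.2.2))
        (id : List Bool → List Bool) (fun t : List Bool × List Bool × List Bool => mul t.1 t.2.1 t.2.2)) →
    Literature.Computability.Cryptography.IsQSolvable (fun x => {y : List Bool |
      ∀ (p : List Bool) (gs : List (List Bool)),
        x = Literature.Computability.Complexity.boolPair p ((Computability.encodingList Bool).listBool.encode gs) →
        (∀ g ∈ gs, lab p g = true) →
        Computability.encodeNat (Set.ncard (⋂₀ {S : Set (List Bool) | one p ∈ S ∧ (∀ g ∈ gs, g ∈ S) ∧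
          ∀ a ∈ S, ∀ b ∈ S, mul p a b ∈ S})) <+: y})

/-- **S6's conclusion — `SamplerCompleteness`** (the analysis of the ideal sampler; an arithmetic
statement, no machines): there are exponents `A, C, E` and `d₀` such that for every fundamental `−d`,
`d ≥ d₀`, with `Y = d^A`, `R = ⌊log₂ d⌋^C`, `E' = ⌊log₂ d⌋^E`: if `3 ∣ h_K` and `3 ∣ h_F` (the completeness
scenario of MIRROR(d): `3 ∣ h(−d)` and `ε_F` not primary) then the pool of `K` or the pool of `F` is GOOD —
acceptance `#pool/(Y R) ≥ 1/E'` and at least half of the pool are torsion witnesses. Derivation (stub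
`stub_samplerCompleteness`): take the bright field `L` of S2 (`κ_L ≥ c/log d`); S3 summed over the `h_L`
classes gives `#{N I ≤ Y} = κ_L Y ± h_L B (12d)^A √Y = κ_L Y (1 ± 1/100)` once `Y ≥ d^{2A+4}`
(`h_L ≤ |d_L|`), and per class `N_C(Y) = (κ_L/h_L) Y (1 ± 1/100)`; the 3′-Hall subgroup statistic
(`{g : 3 ∤ ord g}` is the subgroup of index `3^{v₃(h)} ≥ 3`; tree `three_dvd_classNumber_iff_one_lt_natCard`)
makes `≥ (2/3)(0.98)` of these ideals witnesses; the cap removes at most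
`∑_{a ≤ Y, r(a) > R} r(a) ≤ ∑_{a ≤ Y} τ(a)²/R ≪ Y log³Y / R ≤ κ_L Y/10` for `R = ⌊log₂ d⌋^6`, `d ≥ d₀`
(`r(a) ≤ τ(a)`: `card_ideals_absNorm_eq_le_card_divisors`, PROVED; `∑ τ² ≪ x log³ x`: elementary, cf.
`HallgrenClassGroupDivisorSums`); hence `#pool ≥ 0.9 κ_L Y ≥ Y R / ⌊log₂ d⌋^{C+2}` and
`#witnessPool ≥ 0.65·#{N I ≤ Y} − 0.1 κ_L Y ≥ #pool / 2`. Why it might fail: only constants as typed;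
size M. Testable: triage j010750 / j009565 (rate `≈ (6/π²) L(1,χ)/R` for the PRIMITIVE variant, law uniform
to the sampling floor, witness fraction `= 1 − 3^{−v₃(h)}`, both signatures incl. `ℚ(√1641)`, the mirror
of Disproof's `d = 547`). -/
def SamplerCompleteness : Prop :=
  ∃ A C E d₀ : ℕ, ∀ d : ℕ, IsNegFundamentalDiscr d → d₀ ≤ d →
    ∀ (K : Type) [Field K] [NumberField K], Module.finrank ℚ K = 2 →
      NumberField.discr K = -(d : ℤ) →
    ∀ (F : Type) [Field F] [NumberField F], Module.finrank ℚ F = 2 →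
      (∃ α : F, α ^ 2 = ((3 * d : ℕ) : F)) →
        3 ∣ NumberField.classNumber K → 3 ∣ NumberField.classNumber F →
          PoolGood K (d ^ A) (Nat.log 2 d ^ C) (Nat.log 2 d ^ E) ∨
            PoolGood F (d ^ A) (Nat.log 2 d ^ C) (Nat.log 2 d ^ E)

/-! ## Registered stubs (7) -/

/-- **S1 `stub_refinedScholz`** — the statement `RefinedScholz` above (theorem in print; formally XXL,
vendor first). -/
theorem stub_refinedScholz : RefinedScholz := by
  sorry

/-- **S2 `stub_mirrorBright`** — the statement `MirrorBright` above (provable NOW from tree theorems; M). -/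
theorem stub_mirrorBright : MirrorBright := by
  sorry

/-- **S3 `stub_classEquidistribution`** — the statement `ClassEquidistribution` above (M imaginary + L real). -/
theorem stub_classEquidistribution : ClassEquidistribution := by
  sorry

/-- **S4 `stub_realClassOrder`** — the statement `RealClassOrderQSolvable` above (XL, HARDEST, the
source-risk stub). -/
theorem stub_realClassOrder : RealClassOrderQSolvable := by
  sorry

/-- **S5 `stub_whiteBoxAbelianOrder`** — the statement `WhiteBoxAbelianOrderQSolvable` above
(= `DarkClassGroups.AbelianGroupOrderFBQP`, stmt-QuantumAdvantage-3193, verbatim; L). -/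
theorem stub_whiteBoxAbelianOrder : WhiteBoxAbelianOrderQSolvable := by
  sorry

/-- **S6 `stub_samplerCompleteness`** (M; arithmetic of the sampler, see `SamplerCompleteness`):
brightness of one side (S2) + equidistribution (S3) + the 3′-Hall torsion statistic + the divisor bound
for the cap ⇒ the bright pool is GOOD. This is where the MIRROR carries the dark case: S6 never needs to
know WHICH of `K`, `F` is bright. -/
theorem stub_samplerCompleteness : MirrorBright → ClassEquidistribution → SamplerCompleteness := by
  sorry

/-- **S7 `stub_mirrorProgram`** (XL plumbing on tree rails; the MIRROR TRIPLE TEST as a `BPP^{BQP}`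
decision, written as the search problem "output the bit `[x ∈ IQ3]` on wire `0`"). Route:
`isQSolvable_of_mem_FPRel_BQP_holds` (PROVED: `A ∈ BQP`, `G ∈ FP^A`, coin polynomial `q`, extension-closed
`R` — `iqThreeBitRel` is — and coin success `≥ 3/4` ⇒ `IsQSolvable R`).
(i) ONE ORACLE `A := FACT ⊕ OrdK ⊕ OrdF ⊕ Unit ∈ BQP` (joins along input-length residues: `IsQSolvable.paritySum`;
each summand a bit-language `{⟨w, bin i⟩ : promise(w) ∧ bit i of THE answer on w}` put in `BQP` by
`isQSolvable_classicalWrap_holds` + `mem_BQP_of_isQSolvable_bit`, promises checked inside with `FACT`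
(square-freeness) or in `P` (valid form labels)): `FACT` (hypothesis `FACT_mem_BQP`, tree `_holds`);
`OrdK` = bits of `|⟨f⟩|` from S5 instantiated with the form class group of discriminant `−d` (instance
obligations: `composeGC`, `reduceGC`, `mem_reducedForms_iff`, `FormGroup.classOf_*`); `OrdF` = bits of
`ord[(a, b + θ)]` from S4; `Unit` = bits of `(a mod 9, b mod 9)` of `ε_{D'}` from
`Hallgren2007_regulator_qsolvable_delim` ∘ `JacobsonWilliams2008_unitResidue_mem_FP` (`m = 9`; the regulator
output `⌊R⌋/⌈R⌉` is within `1` of `log ε₀`, `exists_regulator_eq_log` / `regulator_eq_log_of_sq_eq_natCast`,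
PROVED; the residues do not depend on which of the two integers came out).
(ii) `G ∈ FP^A` on `⟨x, coins⟩`: `d := decodeNat x`; reject if `encodeNat d ≠ x` (non-canonical, incl.
`[]`: Disproof §0, `Negative.nil_not_mem`); if `d < max(d₀, 5)` (`d₀` from S6; S1 needs `4 < d`) answer by the finite table
`[d ∈ iqThreeSet]` (classical `if`, in `FP`); fundamentality of `−d` from the factorisation of `d`
(binary search on `FACT`); `m := sqfKernel d`, `D' := mirrorRadicand d`; T1: `IsPrimary d a b` from `Unit`;
T2 (`L = K`, `T := ⌊log₂ d⌋^{E+1}` trials): coins `a ≤ Y := d^A`; factor `a`; for each `p^e ∥ a` list the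
ideals of norm `p^e` from the splitting type of `p` (Kronecker symbol; square roots of `−d` mod `p` by
Tonelli–Shanks on coins / `SquareRootsModulo(TwoPower)`, `ReducedFormOfSplitNumber`, `FormIdeals(Structure)`),
assemble the `r_K(a)` ideals of norm `a` as pairs `(g, primitive form (a/g², B, C))`, discard if
`r_K(a) > R := ⌊log₂ d⌋^C`, pick `j ≤ R` from coins, reduce the `j`-th form (`reduceGC`), query `OrdK`,
fire if `3 ∣ ord`; T3: the same in `F` with data `(D', a₁, b)` ↦ `(a₁, b + θ)` and `OrdF`; output
`[T1 ∨ T2 ∨ T3]`. Everything classical is integer arithmetic + parsing in the tree's `FP`/`CodeFP` model.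
(iii) SUCCESS `≥ 3/4` for every `x` (w.r.t. the TRUE oracle; oracle error is absorbed by the principle):
off-language / table / non-fundamental inputs are answered deterministically and correctly; for
fundamental `d ≥ d₀`, `d > 4`, let `K` (`exists_numberField_discr_eq`), `F`, `(a, b)` be the witnesses —
SOUNDNESS (answer YES ⇒ `d ∈ S`) holds on every coin string: T1 ⇒ `3 ∣ h(−d)` (S1 `←`, right
disjunct); T3 ⇒ `3 ∣ |Cl(𝓞_F)| = h_F` (Lagrange) ⇒ `3 ∣ h(−d)` (S1 `←`, left disjunct); T2 ⇒
`3 ∣ |Cl(𝓞_K)| = h_K = h(−d)` (`card_reducedForms_eq_classNumber` /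
`IsNegFundamentalDiscr.classNumber_eq_card_classGroup`); COMPLETENESS: if `d ∈ S` and T1 fails then
`3 ∣ h_F` (S1 `→`) and `3 ∣ h_K`, so S6 makes the pool of `K` or of `F` GOOD: each trial accepts with
probability `≥ ⌊log₂ d⌋^{−E}` and an accepted sample is uniform on the pool, hence a witness with
probability `≥ 1/2`; `T` independent trials miss with probability `≤ (1 − ⌊log₂ d⌋^{−E}/2)^T ≤ e^{−4} < 1/4`.
The sampler's law is EXACTLY uniform on `samplerPool` (a pool ideal `I` is output iff the coins pick
`a = N I` and `j` = the index of `I` among the `r(a)` ideals of norm `a`: probability `1/(Y R)` each;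
acceptance `#pool/(Y R)` per trial), which is what makes S6's pool statement the right interface. Why it might fail: plumbing only (the one delicate brick is the ideal
enumeration ↔ `{I : N I = a}` bijection in both signatures, for which `FormIdeals*` and
`card_ideals_absNorm_eq_le_card_divisors` exist); size XL. -/
theorem stub_mirrorProgram :
    RefinedScholz → SamplerCompleteness → RealClassOrderQSolvable → WhiteBoxAbelianOrderQSolvable →
      Hallgren2007_regulator_qsolvable_delim → JacobsonWilliams2008_unitResidue_mem_FP → FACT_mem_BQP →
        IsQSolvable iqThreeBitRel := by
  sorry

/-! ## Composition (sorry-free) -/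

/-- **From the seven stub STATEMENTS to `IQ3 ∈ BQP`** (real proof): decision from search
(`mem_BQP_of_isQSolvable_bit`, with the tree's discharged Born-rule and unitarity facts) applied to the
program S7, fed with S1, S6 (from S2, S3), S4, S5 and the three PROVED tree facts it names. -/
theorem IqThreeMemBQP_of_parts (h1 : RefinedScholz) (h2 : MirrorBright) (h3 : ClassEquidistribution)
    (h4 : RealClassOrderQSolvable) (h5 : WhiteBoxAbelianOrderQSolvable)
    (h6 : MirrorBright → ClassEquidistribution → SamplerCompleteness)
    (h7 : RefinedScholz → SamplerCompleteness → RealClassOrderQSolvable → WhiteBoxAbelianOrderQSolvable →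
      Hallgren2007_regulator_qsolvable_delim → JacobsonWilliams2008_unitResidue_mem_FP → FACT_mem_BQP →
        IsQSolvable iqThreeBitRel) :
    iqThreeLang ∈ BQP :=
  mem_BQP_of_isQSolvable_bit (fun n m => QCircuit.outputPMF_apply_holds) cliffordT_isUnitary_holds
    iqThreeBit_eq_true_iff
    (h7 h1 (h6 h2 h3) h4 h5 Hallgren2007_regulator_qsolvable_delim_holds
      JacobsonWilliams2008_unitResidue_mem_FP_holds FACT_mem_BQP_holds)

/-- **The skeleton concludes the crux BY NAME**: `ArithStatLadder.IqThreeMemBQP`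
(stmt-QuantumAdvantage-2424) from the seven REGISTERED stubs, discharged inside the proof in registration
order S1 `stub_refinedScholz` · S2 `stub_mirrorBright` · S3 `stub_classEquidistribution` · S4 `stub_realClassOrder` ·
S5 `stub_whiteBoxAbelianOrder` · S6 `stub_samplerCompleteness` · S7 `stub_mirrorProgram`, through the sorry-free
`IqThreeMemBQP_of_parts` (whose hypotheses are exactly the seven stub STATEMENTS) and the reading
`iqThreeMemBQP_iff`. No `sorry` of its own; `sorry` only inside the `stub_*` it applies. -/
theorem IqThreeMemBQP_of :
    Summit.QuantumAdvantage.QuantumAdvantage.Theses.ArithStatLadder.IqThreeMemBQP :=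
  iqThreeMemBQP_iff.2
    (IqThreeMemBQP_of_parts stub_refinedScholz stub_mirrorBright stub_classEquidistribution
      stub_realClassOrder stub_whiteBoxAbelianOrder stub_samplerCompleteness stub_mirrorProgram)

end Summit.QuantumAdvantage.QuantumAdvantage.Cruxes.IqThreeMemBQP.MirrorDodge
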